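import Summits.HodgeConjecture.CorCM.Census.TypeStabiliserIndexTwo
import Summits.HodgeConjecture.CorCM.Census.QuarticInversionDictionary

/-!
# The quartic inversion twists: the subgroup `ι(ℤ/2 × B)`, `|G| = 8|B|`, and the three subgroups of index two over it

COR-CM (cell `pub-hodgecm2`, stage 2 of the Hodge ladder), count-neutral KERNEL COMBINATORICS by the binder seat b23 (gen 44; claim
QUARTIC-INVERSION, HOME/INBOX.md l.12829).  Pure group theory along a quartic inversion datum `D : Datum G c B ζ`
(`Census/QuarticInversionDictionary.lean`); bookkeeping definitions with bodies (`ιHom`, `cosetPair`, `subY`, `subT`, `subTY`, `cosetEquiv`) +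
theorems; no `decide` beyond closed identities in `ZMod 2`, no certificate, no named fact, no `sorry`.  `Interfaces.lean` (C1), every E term, B01,
`Transposition/*`, `PortJoin/*` untouched.
HONEST FRAMING: `HC_CM` is NOT proved, here or anywhere in the tree; nothing here is a period, a count of record or a headline.

CONTENT.
* §1 `ιHom D : Multiplicative (ℤ/2 × B) →* G`, its range `ι(H₀)`, and **`|G| = 8|B|`** (`card_eq_eight_mul`, from the bijection
  `Fin 4 × (ℤ/2 × B) ≃ G` of the four cosets, `cosetEquiv`).
* §2 **The three subgroups of index two containing `ι(H₀)`**: `subY = ι(H₀) ⊔ y ι(H₀)` (the column met before: `Dic(ℤ/2 × B)` for `ζ = 1`,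
  `ℤ/2 × Dih(B)` for `ζ = 0`), `subT = ι(H₀) ⊔ t ι(H₀) ≅ ℤ/4 × B` (the quartic twist), `subTY = ι(H₀) ⊔ t y ι(H₀)`; all built by one device
  `cosetPair g σ e` (`ι a · g = g · ι(σ a)`, `g² = ι e`); each has index two (`index_subY/T/TY`, by Mathlib's `Subgroup.index_eq_two_iff`), contains
  `ι(H₀)`, and they are pairwise distinct.  The sequel `Census/QuarticInversionStabiliser.lean` locates the type-stabiliser subgroup `𝒦(G, c)` among
  them and derives the floors of the column.  All [folklore].

## References
* [Pohlmann1968] H. Pohlmann, Algebraic cycles on abelian varieties of complex multiplication type, Ann. of Math. 88 (1968), Thm 1.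
-/

namespace Summit.HodgeConjecture.CorCM.Census.QuarticInversion

open Finset

noncomputable section

section Basic

variable {G : Type*} [Group G] {c : G} {A : Type} [AddCommGroup A] {ζ : ZMod 2} (D : Datum G c A ζ)

/-! ## §1 The subgroup `ι(ℤ/2 × B)` and the order of `G` -/

/-- `ι` as a homomorphism `Multiplicative (ℤ/2 × B) →* G`. [folklore] -/
def ιHom : Multiplicative (ZMod 2 × A) →* G where
  toFun a := D.ι a.toAdd
  map_one' := ι_zero D
  map_mul' a b := D.map_add a.toAdd b.toAdd

/-- `ιHom (ofAdd a) = ι a`. [folklore] -/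
@[simp] theorem ιHom_apply (a : ZMod 2 × A) : ιHom D (Multiplicative.ofAdd a) = D.ι a := rfl

/-- `ι a ∈ ι(ℤ/2 × B)` (membership in the range is Mathlib's `MonoidHom.mem_range`, the witness being `ofAdd a`). [folklore] -/
theorem ι_mem_ιRange (a : ZMod 2 × A) : D.ι a ∈ (ιHom D).range := ⟨Multiplicative.ofAdd a, rfl⟩

/-- `y ι a ∉ ι(ℤ/2 × B)`. [folklore] -/
theorem yι_notMem_ιRange (a : ZMod 2 × A) : D.y * D.ι a ∉ (ιHom D).range := fun h => by
  obtain ⟨b, hb⟩ := MonoidHom.mem_range.mp h; exact ι_ne_yι D b.toAdd a hb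

/-- `t ι a ∉ ι(ℤ/2 × B)`. [folklore] -/
theorem tι_notMem_ιRange (a : ZMod 2 × A) : D.t * D.ι a ∉ (ιHom D).range := fun h => by
  obtain ⟨b, hb⟩ := MonoidHom.mem_range.mp h; exact ι_ne_tι D b.toAdd a hb

/-- `t y ι a ∉ ι(ℤ/2 × B)`. [folklore] -/
theorem tyι_notMem_ιRange (a : ZMod 2 × A) : D.t * (D.y * D.ι a) ∉ (ιHom D).range := fun h => by
  obtain ⟨b, hb⟩ := MonoidHom.mem_range.mp h; exact ι_ne_tyι D b.toAdd a hb

/-- The element of `G` in coset `k` over `a`: `ι a`, `y ι a`, `t ι a`, `t y ι a`. [folklore] -/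
def cosetElt (k : Fin 4) (a : ZMod 2 × A) : G := ![D.ι a, D.y * D.ι a, D.t * D.ι a, D.t * (D.y * D.ι a)] k

/-- The coset map `Fin 4 × (ℤ/2 × B) → G` is injective. [folklore] -/
theorem cosetElt_injective : Function.Injective fun p : Fin 4 × (ZMod 2 × A) => cosetElt D p.1 p.2 := by
  rintro ⟨k, a⟩ ⟨l, b⟩ h
  simp only at h
  fin_cases k <;> fin_cases l <;> simp only [cosetElt, Fin.zero_eta, Fin.mk_one, Fin.reduceFinMk, Matrix.cons_val_zero,
    Matrix.cons_val_one, Matrix.cons_val] at h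
  · exact Prod.ext rfl (D.inj h)
  · exact absurd h (ι_ne_yι D a b)
  · exact absurd h (ι_ne_tι D a b)
  · exact absurd h (ι_ne_tyι D a b)
  · exact absurd h.symm (ι_ne_yι D b a)
  · exact Prod.ext rfl (yι_injective D h)
  · exact absurd h (yι_ne_tι D a b)
  · exact absurd h (yι_ne_tyι D a b)
  · exact absurd h.symm (ι_ne_tι D b a)
  · exact absurd h.symm (yι_ne_tι D b a)
  · exact Prod.ext rfl (tι_injective D h)
  · exact absurd h (tι_ne_tyι D a b)
  · exact absurd h.symm (ι_ne_tyι D b a)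
  · exact absurd h.symm (yι_ne_tyι D b a)
  · exact absurd h.symm (tι_ne_tyι D b a)
  · exact Prod.ext rfl (tyι_injective D h)

/-- The coset map is surjective. [folklore] -/
theorem cosetElt_surjective : Function.Surjective fun p : Fin 4 × (ZMod 2 × A) => cosetElt D p.1 p.2 := by
  intro g
  obtain ⟨a, h | h | h | h⟩ := D.exhaust g
  · exact ⟨(0, a), h.symm⟩
  · exact ⟨(1, a), h.symm⟩
  · exact ⟨(2, a), h.symm⟩
  · exact ⟨(3, a), h.symm⟩

/-- **The bijection `Fin 4 × (ℤ/2 × B) ≃ G` of the four cosets.** [folklore] -/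
def cosetEquiv : Fin 4 × (ZMod 2 × A) ≃ G :=
  Equiv.ofBijective _ ⟨cosetElt_injective D, cosetElt_surjective D⟩

end Basic

section Card

variable {G : Type*} [Group G] [Fintype G] {c : G} {A : Type} [AddCommGroup A] [Fintype A] {ζ : ZMod 2} (D : Datum G c A ζ)

include D in
/-- **`|G| = 8|B|`.** [folklore] -/
theorem card_eq_eight_mul : Fintype.card G = 8 * Fintype.card A := by
  rw [← Fintype.card_congr (cosetEquiv D), Fintype.card_prod, Fintype.card_prod, ZMod.card, Fintype.card_fin]
  ring

end Card

/-! ## §2 The three subgroups of index two over `ι(ℤ/2 × B)` -/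

section Cosets

variable {G : Type*} [Group G] {c : G} {A : Type} [AddCommGroup A] {ζ : ZMod 2} (D : Datum G c A ζ)

/-- **The union of `ι(H₀)` and one more coset `g ι(H₀)`** for `g` normalising `ι` (`ι a · g = g · ι(σ a)`) with `g² = ι e`: a subgroup. [folklore] -/
def cosetPair (g : G) (σ : ZMod 2 × A → ZMod 2 × A) (hσ : ∀ a, D.ι a * g = g * D.ι (σ a)) (e : ZMod 2 × A)
    (he : g * g = D.ι e) : Subgroup G where
  carrier := {b | ∃ a, b = D.ι a ∨ b = g * D.ι a}
  one_mem' := ⟨0, Or.inl (ι_zero D).symm⟩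
  mul_mem' := by
    rintro _ _ ⟨a, rfl | rfl⟩ ⟨b, rfl | rfl⟩
    · exact ⟨a + b, Or.inl (D.map_add a b).symm⟩
    · exact ⟨σ a + b, Or.inr (by rw [← mul_assoc, hσ, mul_assoc, ← D.map_add])⟩
    · exact ⟨a + b, Or.inr (by rw [mul_assoc, ← D.map_add])⟩
    · exact ⟨e + (σ a + b), Or.inl (by rw [mul_assoc, ← mul_assoc (D.ι a), hσ, mul_assoc, ← D.map_add, ← mul_assoc, he, ← D.map_add])⟩
  inv_mem' := by
    rintro _ ⟨a, rfl | rfl⟩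
    · exact ⟨-a, Or.inl (ι_neg D a).symm⟩
    · refine ⟨-(e + σ a), Or.inr ?_⟩
      symm
      apply eq_inv_of_mul_eq_one_right
      rw [mul_assoc, ← mul_assoc (D.ι a), hσ, mul_assoc, ← D.map_add, ← mul_assoc, he, ← D.map_add, ← add_assoc, add_neg_cancel, ι_zero]

/-- Membership in a coset pair. [folklore] -/
theorem mem_cosetPair_iff {g : G} {σ : ZMod 2 × A → ZMod 2 × A} {hσ : ∀ a, D.ι a * g = g * D.ι (σ a)} {e : ZMod 2 × A}
    {he : g * g = D.ι e} (b : G) : b ∈ cosetPair D g σ hσ e he ↔ ∃ a, b = D.ι a ∨ b = g * D.ι a := Iff.rfl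

/-- **`subY = ι(H₀) ⊔ y ι(H₀)`** (`y` inverts, `y² = ι(ζ,0)`). [folklore] -/
def subY : Subgroup G := cosetPair D D.y (fun a => -a) (fun a => ι_mul_y D a) (ζ, 0) D.y_mul_y

/-- **`subT = ι(H₀) ⊔ t ι(H₀) ≅ ℤ/4 × B`** (`t` central, `t² = c = ι(1,0)`). [folklore] -/
def subT : Subgroup G := cosetPair D D.t id (fun a => ι_mul_t D a) (1, 0) (D.t_mul_t.trans D.map_c.symm)

/-- `ι a · (t y) = (t y) · ι(−a)`. [folklore] -/
theorem ι_mul_ty (a : ZMod 2 × A) : D.ι a * (D.t * D.y) = D.t * D.y * D.ι (-a) := by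
  rw [← mul_assoc, ι_mul_t, mul_assoc, ι_mul_y, mul_assoc]

/-- `(t y)² = ι(ζ, 0)`. [folklore] -/
theorem ty_mul_ty : D.t * D.y * (D.t * D.y) = D.ι (ζ, 0) := by
  rw [← mul_assoc, t_mul_y_mul_t, D.y_mul_y]

/-- **`subTY = ι(H₀) ⊔ t y ι(H₀)`**. [folklore] -/
def subTY : Subgroup G := cosetPair D (D.t * D.y) (fun a => -a) (fun a => ι_mul_ty D a) (ζ, 0) (ty_mul_ty D)

/-- Membership in `subY`. [folklore] -/
theorem mem_subY_iff (b : G) : b ∈ subY D ↔ ∃ a, b = D.ι a ∨ b = D.y * D.ι a := Iff.rfl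

/-- Membership in `subT`. [folklore] -/
theorem mem_subT_iff (b : G) : b ∈ subT D ↔ ∃ a, b = D.ι a ∨ b = D.t * D.ι a := Iff.rfl

/-- Membership in `subTY`. [folklore] -/
theorem mem_subTY_iff (b : G) : b ∈ subTY D ↔ ∃ a, b = D.ι a ∨ b = D.t * (D.y * D.ι a) := by
  simp only [subTY, mem_cosetPair_iff, mul_assoc]

/-- `ι a` lies in all three. [folklore] -/
theorem ι_mem_sub (a : ZMod 2 × A) : D.ι a ∈ subY D ∧ D.ι a ∈ subT D ∧ D.ι a ∈ subTY D :=
  ⟨⟨a, Or.inl rfl⟩, ⟨a, Or.inl rfl⟩, (mem_subTY_iff D _).mpr ⟨a, Or.inl rfl⟩⟩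

/-- `ι(H₀) ≤ subY`, `subT`, `subTY`. [folklore] -/
theorem ιRange_le_sub : (ιHom D).range ≤ subY D ∧ (ιHom D).range ≤ subT D ∧ (ιHom D).range ≤ subTY D := by
  refine ⟨fun g hg => ?_, fun g hg => ?_, fun g hg => ?_⟩ <;> obtain ⟨a, rfl⟩ := MonoidHom.mem_range.mp hg
  · exact (ι_mem_sub D a.toAdd).1
  · exact (ι_mem_sub D a.toAdd).2.1
  · exact (ι_mem_sub D a.toAdd).2.2

/-- `y ι a ∈ subY`, `∉ subT`, `∉ subTY`. [folklore] -/
theorem yι_mem (a : ZMod 2 × A) : D.y * D.ι a ∈ subY D ∧ D.y * D.ι a ∉ subT D ∧ D.y * D.ι a ∉ subTY D := by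
  refine ⟨⟨a, Or.inr rfl⟩, ?_, ?_⟩
  · rintro ⟨b, h | h⟩
    · exact ι_ne_yι D b a h.symm
    · exact yι_ne_tι D a b h
  · rw [mem_subTY_iff]
    rintro ⟨b, h | h⟩
    · exact ι_ne_yι D b a h.symm
    · exact yι_ne_tyι D a b h

/-- `t ι a ∈ subT`, `∉ subY`, `∉ subTY`. [folklore] -/
theorem tι_mem (a : ZMod 2 × A) : D.t * D.ι a ∈ subT D ∧ D.t * D.ι a ∉ subY D ∧ D.t * D.ι a ∉ subTY D := by
  refine ⟨⟨a, Or.inr rfl⟩, ?_, ?_⟩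
  · rintro ⟨b, h | h⟩
    · exact ι_ne_tι D b a h.symm
    · exact yι_ne_tι D b a h.symm
  · rw [mem_subTY_iff]
    rintro ⟨b, h | h⟩
    · exact ι_ne_tι D b a h.symm
    · exact tι_ne_tyι D a b h

/-- `t y ι a ∈ subTY`, `∉ subY`, `∉ subT`. [folklore] -/
theorem tyι_mem (a : ZMod 2 × A) : D.t * (D.y * D.ι a) ∈ subTY D ∧ D.t * (D.y * D.ι a) ∉ subY D ∧ D.t * (D.y * D.ι a) ∉ subT D := by
  refine ⟨(mem_subTY_iff D _).mpr ⟨a, Or.inr rfl⟩, ?_, ?_⟩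
  · rintro ⟨b, h | h⟩
    · exact ι_ne_tyι D b a h.symm
    · exact yι_ne_tyι D b a h.symm
  · rintro ⟨b, h | h⟩
    · exact ι_ne_tyι D b a h.symm
    · exact tι_ne_tyι D b a h.symm

/-- `−(1, 0) + a`-type bookkeeping: `t⁻¹·…`-free products used for the index computations. [folklore] -/
theorem yι_mul_t (a : ZMod 2 × A) : D.y * D.ι a * D.t = D.t * (D.y * D.ι ((1, 0) + a)) := by
  rw [mul_assoc, ι_mul_t, ← mul_assoc, D.y_mul_t, ← t_mul_c, mul_assoc D.t c D.y, ← y_mul_c, mul_assoc, mul_assoc, c_mul_ι]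

/-- `t ι a · t = ι((1,0) + a)`. [folklore] -/
theorem tι_mul_t (a : ZMod 2 × A) : D.t * D.ι a * D.t = D.ι ((1, 0) + a) := by
  rw [mul_assoc, ι_mul_t, ← mul_assoc, D.t_mul_t, c_mul_ι]

/-- `t y ι a · t = y ι a`. [folklore] -/
theorem tyι_mul_t (a : ZMod 2 × A) : D.t * (D.y * D.ι a) * D.t = D.y * D.ι a := by
  rw [mul_assoc, mul_assoc, ι_mul_t, ← mul_assoc, ← mul_assoc, t_mul_y_mul_t]

/-- `y ι a · y = ι((ζ,0) − a)`. [folklore] -/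
theorem yι_mul_y (a : ZMod 2 × A) : D.y * D.ι a * D.y = D.ι ((ζ, 0) + -a) := by
  rw [mul_assoc, ι_mul_y, ← mul_assoc, D.y_mul_y, ← D.map_add]

/-- `t ι a · y = t y ι(−a)`. [folklore] -/
theorem tι_mul_y (a : ZMod 2 × A) : D.t * D.ι a * D.y = D.t * (D.y * D.ι (-a)) := by
  rw [mul_assoc, ι_mul_y]

/-- `t y ι a · y = t ι((ζ,0) − a)`. [folklore] -/
theorem tyι_mul_y (a : ZMod 2 × A) : D.t * (D.y * D.ι a) * D.y = D.t * D.ι ((ζ, 0) + -a) := by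
  rw [mul_assoc, yι_mul_y]

/-- **`subY` has index two** (right multiplication by `t` swaps it with its complement). [folklore] -/
theorem index_subY : (subY D).index = 2 := by
  refine Subgroup.index_eq_two_iff.mpr ⟨D.t, fun b => ?_⟩
  obtain ⟨a, rfl | rfl | rfl | rfl⟩ := D.exhaust b
  · rw [ι_mul_t]; exact Or.inr ⟨(ι_mem_sub D a).1, (tι_mem D a).2.1⟩
  · rw [yι_mul_t]; exact Or.inr ⟨(yι_mem D a).1, (tyι_mem D _).2.1⟩
  · rw [tι_mul_t]; exact Or.inl ⟨(ι_mem_sub D _).1, (tι_mem D a).2.1⟩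
  · rw [tyι_mul_t]; exact Or.inl ⟨(yι_mem D a).1, (tyι_mem D a).2.1⟩

/-- **`subT` has index two** (right multiplication by `y`). [folklore] -/
theorem index_subT : (subT D).index = 2 := by
  refine Subgroup.index_eq_two_iff.mpr ⟨D.y, fun b => ?_⟩
  obtain ⟨a, rfl | rfl | rfl | rfl⟩ := D.exhaust b
  · rw [ι_mul_y]; exact Or.inr ⟨(ι_mem_sub D a).2.1, (yι_mem D _).2.1⟩
  · rw [yι_mul_y]; exact Or.inl ⟨(ι_mem_sub D _).2.1, (yι_mem D a).2.1⟩
  · rw [tι_mul_y]; exact Or.inr ⟨(tι_mem D a).1, (tyι_mem D _).2.2⟩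
  · rw [tyι_mul_y]; exact Or.inl ⟨(tι_mem D _).1, (tyι_mem D a).2.2⟩

/-- **`subTY` has index two** (right multiplication by `y`). [folklore] -/
theorem index_subTY : (subTY D).index = 2 := by
  refine Subgroup.index_eq_two_iff.mpr ⟨D.y, fun b => ?_⟩
  obtain ⟨a, rfl | rfl | rfl | rfl⟩ := D.exhaust b
  · rw [ι_mul_y]; exact Or.inr ⟨(ι_mem_sub D a).2.2, (yι_mem D _).2.2⟩
  · rw [yι_mul_y]; exact Or.inl ⟨(ι_mem_sub D _).2.2, (yι_mem D a).2.2⟩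
  · rw [tι_mul_y]; exact Or.inl ⟨(tyι_mem D _).1, (tι_mem D a).2.2⟩
  · rw [tyι_mul_y]; exact Or.inr ⟨(tyι_mem D a).1, (tι_mem D _).2.2⟩

/-- **The three subgroups are pairwise distinct.** [folklore] -/
theorem sub_ne : subY D ≠ subT D ∧ subY D ≠ subTY D ∧ subT D ≠ subTY D := by
  refine ⟨fun h => ?_, fun h => ?_, fun h => ?_⟩
  · have hm : D.y * D.ι 0 ∈ subY D := (yι_mem D 0).1
    rw [h] at hm; exact (yι_mem D 0).2.1 hm
  · have hm : D.y * D.ι 0 ∈ subY D := (yι_mem D 0).1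
    rw [h] at hm; exact (yι_mem D 0).2.2 hm
  · have hm : D.t * D.ι 0 ∈ subT D := (tι_mem D 0).1
    rw [h] at hm; exact (tι_mem D 0).2.2 hm

/-- **An index-two subgroup containing `ι(H₀)` is one of the three.** [folklore] -/
theorem eq_sub_of_index_two {H : Subgroup G} (hH : H.index = 2) (hle : (ιHom D).range ≤ H) :
    H = subY D ∨ H = subT D ∨ H = subTY D := by
  have key : ∀ (K : Subgroup G), K.index = 2 → K ≤ H → K = H := fun K hK hKH =>
    Summit.HodgeConjecture.CorCM.Census.IndexTwo.eq_of_le_of_index_eq hKH (hK.trans hH.symm) (by rw [hH]; norm_num)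
  have hι : ∀ a, D.ι a ∈ H := fun a => hle (ι_mem_ιRange D a)
  by_cases hy : D.y ∈ H
  · refine Or.inl (key _ (index_subY D) ?_).symm
    rintro _ ⟨a, rfl | rfl⟩
    · exact hι a
    · exact H.mul_mem hy (hι a)
  by_cases ht : D.t ∈ H
  · refine Or.inr (Or.inl (key _ (index_subT D) ?_).symm)
    rintro _ ⟨a, rfl | rfl⟩
    · exact hι a
    · exact H.mul_mem ht (hι a)
  · have hty : D.t * D.y ∈ H := by
      rw [Subgroup.mul_mem_iff_of_index_two hH]
      exact ⟨fun h => absurd h ht, fun h => absurd h hy⟩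
    refine Or.inr (Or.inr (key _ (index_subTY D) ?_).symm)
    intro b hb
    obtain ⟨a, rfl | rfl⟩ := (mem_subTY_iff D b).mp hb
    · exact hι a
    · rw [← mul_assoc]; exact H.mul_mem hty (hι a)

end Cosets

end

end Summit.HodgeConjecture.CorCM.Census.QuarticInversion
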